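/-
Copyright (c) 2026 the pub-hodgecm-mathlib formalisation cell (harness21).  Prover seat hodgecm-mathlib-F0P3a-p01 (g37), FLOOR 0, SUPPORTS-ONLY on h413; β-BOARD v1 R10
(assembler ∕ chair): THE TUBE ROWS OF RECORD — the (T2) trunk's binders `hP3G1`, `hP3G2`, `hP2G3` discharged BY NAME from the ★ row heads (R3, R4, R2+R5).  2026-09-04.
-/
import Summits.HodgeConjecture.HodgeConjecture.Theorems.F0P3cDyRamLabelledOddBoundaryG1            -- ★ p862145 (LH4-p17 (g0)): R3 head
import Summits.HodgeConjecture.HodgeConjecture.Theorems.F0P3cDyRamLabelledOddBoundaryG2OfG1        -- ★ p861531 (LH7-p09 (g0)): R4 ⇐ R3 adapter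
import Summits.HodgeConjecture.HodgeConjecture.Theorems.F0P3cDyRamOddLabelledG3RowAdapter          -- ★ p861354 (LH4-p10 (g6)): `hG3t_of_cell_and_beyond`
import Summits.HodgeConjecture.HodgeConjecture.Theorems.F0P3cDyRamLabelledOddPureStrataG3OfRecord   -- ★ p861387 (LH4-p11 (g9)): G₃ cell column of record
import Summits.HodgeConjecture.HodgeConjecture.Theorems.F0P3cDyRamLabelledOddBoundaryG3Beyond      -- ★ (LH4-p18 (g0)): G₃ beyond column (R5a ⊔ R5b)
import Summits.HodgeConjecture.HodgeConjecture.Theorems.F0P3cDyRamLabelledOddStageBTable           -- ★ p861403 (this seat): record lemmas; brings `two_le_d_of_v_two_lt_one`, parity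
import HarnessLib

/-!
# Crux `H413`, LH4 «(D-RAM) FOUR-FRAME» road, STAGE 1b (β) — THE TUBE ROWS OF RECORD: `hP3G1`, `hP3G2`, `hP2G3` OF THE (T2) TRUNK, PAID BY NAME

Cell `hodgecm-mathlib` (D-0151), FLOOR 0, crux item H413 = `stmt-HodgeConjecture-24833`, route `HCCMUnconditional`; squad F0∕P3c∕LH4.  THEOREMS ONLY (no `def`, no instance, no
notation, no `sorry`, default heartbeats); ★-only imports; lane `--supports stmt-HodgeConjecture-24833 --as helper` (count-neutral; pays NO row by itself).

WHAT THIS FILE DOES.  The pay line of the tier-0 stub `stub_law_cleanSgn` is `…StageBBoxForm.dyadicFence_cleanSgnFrameConstLawAt_derived_ofRecord_of_box (hbox_of_oddBoxSum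
oddLabelledBoxSum hP3G1 hP3G2 hP2G3 hRest)` ((T3) ★ p861510, (T1) ★ p861261, (T2) ★ p861403).  Three of its four binders are discharged HERE, each stated in the trunk's binder
text VERBATIM (∀-closed over the field, the datum at the derived record `n0DerivedOfRecord d`, the torus element and the tower-sign token): `hP3G1_ofRecord` = LH4-p17 (g0)'s
★ R3 head (β-BOARD R3: ★ p861456 ∕ p861560 ∕ p861608 ∕ p861641 ∕ p861666 ∕ p861907 ∕ p862063 ∕ p862145); `hP3G2_ofRecord` = LH7-p09 (g0)'s ★ p861531 swap adapter over it
(R4); `hP2G3_ofRecord` = LH4-p10 (g6)'s ★ p861354 junction over LH4-p11's ★ p861387 cell column and LH4-p18 (g0)'s ★ `…BoundaryG3Beyond` (R2 + R5: ★ p861290 ∕ p861504 ∕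
p861675 ∕ p861738 ∕ p861837 ∕ p861925), the regime letters (`2 ≤ d`, `d ≤ N₀`, `mc ≤ N₀`, isosceles, parities) discharged from `|2| < 1` and the record.  The fourth binder `hRest`
is ★ p861938 `restSum_eq_restTarget_of_rows` over the seven rest rows (separate file).
HONEST LABEL.  Count-neutral junction (`--supports`); `hRest`, (β), T₊ OPEN; `HC_CM` is proved only modulo the 7 printed citations (2 remaining named inputs: hLiu418 =
`stmt-HodgeConjecture-24832`, h413 = `stmt-HodgeConjecture-24833`) until rung 0 closes.

## References
* [Kottwitz1986BaseChangeUnits] R. E. Kottwitz, *Base change for unit elements of Hecke algebras*, Compositio Math. 60 (1986), §1 pp. 240–241 (lattice counts by strata).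
* [Rogawski1990] J. D. Rogawski, *Automorphic Representations of Unitary Groups in Three Variables*, Ann. of Math. Stud. 123 (1990), §4.9 Prop. 4.9.1 (a)(b) p. 55.
-/

set_option autoImplicit false

noncomputable section

namespace Summit.HodgeConjecture.HodgeConjecture.Cruxes.H413.F0P3cDyRamOddLabelledTubeRowsOfRecord

open Literature.NumberTheory.Automorphic Literature.NumberTheory.Automorphic.HermitianLattice Literature.NumberTheory.Automorphic.UnitaryGroup
open Literature.NumberTheory.Automorphic.UnitaryLatticeTree Literature.NumberTheory.Automorphic.UnitaryThreeFourFrame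
open Summit.HodgeConjecture.HodgeConjecture.Cruxes.H413.F0P3cDyRamFourFramePieces
open Summit.HodgeConjecture.HodgeConjecture.Cruxes.H413.F0P3cDyRamFourFrameCensusDefs
open Summit.HodgeConjecture.HodgeConjecture.Cruxes.H413.F0P3cDyRamStageOneBDefs (mcOfRecord)
open Summit.HodgeConjecture.HodgeConjecture.Cruxes.H413.F0P3cDyRamStageOneBDerivedDefs (n0DerivedOfRecord mcOfRecord_le_n0DerivedOfRecord)
open Summit.HodgeConjecture.HodgeConjecture.Cruxes.H413.F0P3cDyRamDiagonalTorusDefs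
open Summit.HodgeConjecture.HodgeConjecture.Cruxes.H413.F0P3cDyRamDiagonalStrataDefs
open Summit.HodgeConjecture.HodgeConjecture.Cruxes.H413.F0P3cDyRamLabelledOddCountDefs
open Summit.HodgeConjecture.HodgeConjecture.Cruxes.H413.F0P3cDyRamLabelledOddStageBTable (three_mul_sub_two_add_mod_le_n0DerivedOfRecord)
open Summit.HodgeConjecture.HodgeConjecture.Cruxes.H413.F0P3cDyRamLabelledOddBoundaryG1 (finsum_stratum_G1_beyond_shell_labelledOdd_div_relIndex_eq)
open Summit.HodgeConjecture.HodgeConjecture.Cruxes.H413.F0P3cDyRamLabelledOddBoundaryG2OfG1 (finsum_stratum_G2_beyond_shell_labelledOdd_div_relIndex_eq_of_G1)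
open Summit.HodgeConjecture.HodgeConjecture.Cruxes.H413.F0P3cDyRamOddLabelledG3RowAdapter (hG3t_of_cell_and_beyond)
open Summit.HodgeConjecture.HodgeConjecture.Cruxes.H413.F0P3cDyRamLabelledOddPureStrataG3OfRecord (finsum_stratum_G3_shell_labelledOdd_div_relIndex_eq_ofRecord)
open Summit.HodgeConjecture.HodgeConjecture.Cruxes.H413.F0P3cDyRamLabelledOddBoundaryG3Beyond (finsum_stratum_G3_shell_labelledOdd_div_relIndex_beyond)
open Summit.HodgeConjecture.HodgeConjecture.Cruxes.H413.F0P3cDyRamElementDatumParity (isoceles_of_isElementDatum depth_mod_two_eq_of_isElementDatum)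
open Summit.HodgeConjecture.HodgeConjecture.Cruxes.H413.F0P3cDyRamDiagonalKappaCoreHangingClass (two_le_d_of_v_two_lt_one)
open scoped Valued WithZero Matrix MatrixGroups

/-- **`hP3G1` OF RECORD — the capped tube classes of tower 1 beyond the one-slot cell** (the (T2) trunk's binder VERBATIM): LH4-p17 (g0)'s ★ p862145 R3 head
`…LabelledOddBoundaryG1.finsum_stratum_G1_beyond_shell_labelledOdd_div_relIndex_eq`, re-ordered to the trunk's binder. [cite: Kottwitz1986BaseChangeUnits, §1 pp. 240–241]
[cite: Rogawski1990, §4.9 Prop. 4.9.1 (a)(b) p. 55] -/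
theorem hP3G1_ofRecord : (∀ {K : Type} [Field K] [Valued K ℤᵐ⁰] [CompleteSpace K] [Fintype 𝓀[K]] (σ : K →+* K) (ϖ : K) (d t : ℕ),
      Valued.v (2 : K) < 1 → IsRamifiedQuadraticDatum σ ϖ d t →
      ∀ (α β : K) (n₁ n₂ n₃ : ℕ), IsElementDatum σ ϖ (n0DerivedOfRecord d) α β n₁ n₂ n₃ →
      ∀ (T : GL (Fin 3) K), (T : Matrix (Fin 3) (Fin 3) K) = Matrix.diagonal ![α, β, 1] →
      ∀ (ρ s : ℕ), 1 ≤ ρ → n₂ < 2 * ρ + mstarOfRecord d → 2 * ρ + s + d % 2 = n₁ → 2 ∣ s → 2 * ρ + 2 + d % 2 ≤ min n₂ n₃ →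
      ∀ {eB : K}, σ eB = eB → Valued.v eB = 1 → Valued.v ((ϖ ^ mstarOfRecord d)⁻¹ * ((β - 1) * ((ϖ * σ ϖ) ^ ((n₁ - d % 2) / 2))⁻¹ - eB * ((ϖ - σ ϖ) * ((ϖ * σ ϖ) ^ ((d - d % 2) / 2))⁻¹))) ≤ 1 →
      ∀ i : Fin 3,
        ∑ᶠ M ∈ {M : Submodule 𝒪[K] (Fin 3 → K) | M ∈ stratum σ ϖ T ![2 * ρ, 2 * ρ + s, 2 * ρ + s] ∧
            (LatticeInLevel ϖ (d % 2) (Matrix.diagonal ![α - 1, β - 1, 0]) M ∧ ¬ LatticeInLevel ϖ (d % 2 + 1) (Matrix.diagonal ![α - 1, β - 1, 0]) M ∧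
              LatticeInLevel ϖ (mcOfRecord d) (Matrix.diagonal ![(α - 1) * (α - 1), (β - 1) * (β - 1), 0]) M)},
          (labelledOddCount σ ϖ 0 i (valueClassLabel σ ϖ (α - 1) (β - 1) (mstarOfRecord d) d) M : ℚ) /
            ((((unitStabilizer M).map (unitNormMap σ 3)).relIndex (fixedUnitTorus σ 3) : ℕ) : ℚ) =
          (normSign σ eB : ℚ) / 2 * (Fintype.card 𝓀[K] : ℚ) ^ (2 * ρ + s / 2 - 1) *
            (![(0 : ℚ), ((if 2 * d + d % 2 + 2 * ρ ≤ n₂ then (Fintype.card 𝓀[K] : ℚ) - 1 else 0) - (if n₂ + 2 = 2 * d + d % 2 + 2 * ρ then 1 else 0)), (normSign σ (-1 : K) : ℚ) * ((if 2 * d + d % 2 + 2 * ρ ≤ n₃ then (Fintype.card 𝓀[K] : ℚ) - 1 else 0) - (if n₃ + 2 = 2 * d + d % 2 + 2 * ρ then 1 else 0))] : Fin 3 → ℚ) i) := by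
  intro K _ _ _ _ σ ϖ d t h2 hD α β n₁ n₂ n₃ hE T hT ρ s hρ hbey hread hpar hcap eB hσeB heB1 heB i
  exact finsum_stratum_G1_beyond_shell_labelledOdd_div_relIndex_eq h2 hD hE T hT ρ s hρ hbey hread hpar hcap hσeB heB1 heB i


/-- **`hP3G2` OF RECORD — the capped tube classes of tower 2 beyond the cell** (trunk binder VERBATIM): LH7-p09 (g0)'s ★ p861531 (0 1)-swap adapter
`…BoundaryG2OfG1.finsum_stratum_G2_beyond_shell_labelledOdd_div_relIndex_eq_of_G1` over `hP3G1_ofRecord`. [cite: Kottwitz1986BaseChangeUnits, §1 pp. 240–241]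
[cite: Rogawski1990, §4.9 Prop. 4.9.1 (a)(b) p. 55] -/
theorem hP3G2_ofRecord : (∀ {K : Type} [Field K] [Valued K ℤᵐ⁰] [CompleteSpace K] [Fintype 𝓀[K]] (σ : K →+* K) (ϖ : K) (d t : ℕ),
      Valued.v (2 : K) < 1 → IsRamifiedQuadraticDatum σ ϖ d t →
      ∀ (α β : K) (n₁ n₂ n₃ : ℕ), IsElementDatum σ ϖ (n0DerivedOfRecord d) α β n₁ n₂ n₃ →
      ∀ (T : GL (Fin 3) K), (T : Matrix (Fin 3) (Fin 3) K) = Matrix.diagonal ![α, β, 1] →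
      ∀ (ρ s : ℕ), 1 ≤ ρ → n₁ < 2 * ρ + mstarOfRecord d → 2 * ρ + s + d % 2 = n₂ → 2 ∣ s → 2 * ρ + 2 + d % 2 ≤ min n₁ n₃ →
      ∀ {eA : K}, σ eA = eA → Valued.v eA = 1 → Valued.v ((ϖ ^ mstarOfRecord d)⁻¹ * ((α - 1) * ((ϖ * σ ϖ) ^ ((n₂ - d % 2) / 2))⁻¹ - eA * ((ϖ - σ ϖ) * ((ϖ * σ ϖ) ^ ((d - d % 2) / 2))⁻¹))) ≤ 1 →
      ∀ i : Fin 3,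
        ∑ᶠ M ∈ {M : Submodule 𝒪[K] (Fin 3 → K) | M ∈ stratum σ ϖ T ![2 * ρ + s, 2 * ρ, 2 * ρ + s] ∧
            (LatticeInLevel ϖ (d % 2) (Matrix.diagonal ![α - 1, β - 1, 0]) M ∧ ¬ LatticeInLevel ϖ (d % 2 + 1) (Matrix.diagonal ![α - 1, β - 1, 0]) M ∧
              LatticeInLevel ϖ (mcOfRecord d) (Matrix.diagonal ![(α - 1) * (α - 1), (β - 1) * (β - 1), 0]) M)},
          (labelledOddCount σ ϖ 0 i (valueClassLabel σ ϖ (α - 1) (β - 1) (mstarOfRecord d) d) M : ℚ) /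
            ((((unitStabilizer M).map (unitNormMap σ 3)).relIndex (fixedUnitTorus σ 3) : ℕ) : ℚ) =
          (normSign σ eA : ℚ) / 2 * (Fintype.card 𝓀[K] : ℚ) ^ (2 * ρ + s / 2 - 1) *
            (![((if 2 * d + d % 2 + 2 * ρ ≤ n₁ then (Fintype.card 𝓀[K] : ℚ) - 1 else 0) - (if n₁ + 2 = 2 * d + d % 2 + 2 * ρ then 1 else 0)), (0 : ℚ), (normSign σ (-1 : K) : ℚ) * ((if 2 * d + d % 2 + 2 * ρ ≤ n₃ then (Fintype.card 𝓀[K] : ℚ) - 1 else 0) - (if n₃ + 2 = 2 * d + d % 2 + 2 * ρ then 1 else 0))] : Fin 3 → ℚ) i) := by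
  intro K _ _ _ _ σ ϖ d t h2 hD α β n₁ n₂ n₃ hE T hT ρ s hρ hbey hread hpar hcap eA hσeA heA1 heA i
  exact finsum_stratum_G2_beyond_shell_labelledOdd_div_relIndex_eq_of_G1
    (fun T' eB hE' hT' hbey' hread' hpar' hcap' hσeB heB1 heB j => hP3G1_ofRecord σ ϖ d t h2 hD _ _ _ _ _ hE' T' hT' ρ s hρ hbey' hread' hpar' hcap' hσeB heB1 heB j)
    hE T hT hbey hread hpar hcap hσeA heA1 heA i


/-- **`hP2G3` OF RECORD — ALL capped tube classes of tower 3** (trunk binder VERBATIM): LH4-p10's ★ p861354 junction `hG3t_of_cell_and_beyond` over the cell column ★ p861387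
`…PureStrataG3OfRecord.…_eq_ofRecord` (LH4-p11) and the beyond column ★ `…BoundaryG3Beyond.…_beyond` (LH4-p18 (g0) ∕ LH7-p06 (g0) R5), with the regime letters from the record.
[cite: Kottwitz1986BaseChangeUnits, §1 pp. 240–241] [cite: Rogawski1990, §4.9 Prop. 4.9.1 (a)(b) p. 55] -/
theorem hP2G3_ofRecord : (∀ {K : Type} [Field K] [Valued K ℤᵐ⁰] [CompleteSpace K] [Fintype 𝓀[K]] (σ : K →+* K) (ϖ : K) (d t : ℕ),
      Valued.v (2 : K) < 1 → IsRamifiedQuadraticDatum σ ϖ d t →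
      ∀ (α β : K) (n₁ n₂ n₃ : ℕ), IsElementDatum σ ϖ (n0DerivedOfRecord d) α β n₁ n₂ n₃ →
      ∀ (T : GL (Fin 3) K), (T : Matrix (Fin 3) (Fin 3) K) = Matrix.diagonal ![α, β, 1] →
      ∀ (ρ s : ℕ), 1 ≤ ρ → 2 * ρ + s + d % 2 = n₃ → 2 ∣ s → 2 * ρ + 2 + d % 2 ≤ min n₁ n₂ →
      ∀ {eC : K}, σ eC = eC → Valued.v eC = 1 → Valued.v ((ϖ ^ mstarOfRecord d)⁻¹ * ((β - α) * ((ϖ * σ ϖ) ^ ((n₃ - d % 2) / 2))⁻¹ - eC * ((ϖ - σ ϖ) * ((ϖ * σ ϖ) ^ ((d - d % 2) / 2))⁻¹))) ≤ 1 →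
      ∀ i : Fin 3,
        ∑ᶠ M ∈ {M : Submodule 𝒪[K] (Fin 3 → K) | M ∈ stratum σ ϖ T ![2 * ρ + s, 2 * ρ + s, 2 * ρ] ∧
            (LatticeInLevel ϖ (d % 2) (Matrix.diagonal ![α - 1, β - 1, 0]) M ∧ ¬ LatticeInLevel ϖ (d % 2 + 1) (Matrix.diagonal ![α - 1, β - 1, 0]) M ∧
              LatticeInLevel ϖ (mcOfRecord d) (Matrix.diagonal ![(α - 1) * (α - 1), (β - 1) * (β - 1), 0]) M)},
          (labelledOddCount σ ϖ 0 i (valueClassLabel σ ϖ (α - 1) (β - 1) (mstarOfRecord d) d) M : ℚ) /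
            ((((unitStabilizer M).map (unitNormMap σ 3)).relIndex (fixedUnitTorus σ 3) : ℕ) : ℚ) =
          (normSign σ eC : ℚ) / 2 * (Fintype.card 𝓀[K] : ℚ) ^ (2 * ρ + s / 2 - 1) *
            (![(normSign σ (-1 : K) : ℚ) * ((if 2 * d + d % 2 + 2 * ρ ≤ n₁ then (Fintype.card 𝓀[K] : ℚ) - 1 else 0) - (if n₁ + 2 = 2 * d + d % 2 + 2 * ρ then 1 else 0)), ((if 2 * d + d % 2 + 2 * ρ ≤ n₂ then (Fintype.card 𝓀[K] : ℚ) - 1 else 0) - (if n₂ + 2 = 2 * d + d % 2 + 2 * ρ then 1 else 0)), (0 : ℚ)] : Fin 3 → ℚ) i) := by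
  intro K _ _ _ _ σ ϖ d t h2 hD α β n₁ n₂ n₃ hE T hT ρ s hρ hP h2s hcap eC hσeC heC1 heC i
  have h2d : 2 ≤ d := two_le_d_of_v_two_lt_one hD h2
  have hmc : mcOfRecord d ≤ n0DerivedOfRecord d := mcOfRecord_le_n0DerivedOfRecord d
  have hreg0 := three_mul_sub_two_add_mod_le_n0DerivedOfRecord d
  have hdN₀ : d ≤ n0DerivedOfRecord d := le_trans (by omega) hreg0
  have hiso := isoceles_of_isElementDatum hD hE
  obtain ⟨hp1, hp2, hp3⟩ := depth_mod_two_eq_of_isElementDatum hD hE hdN₀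
  exact hG3t_of_cell_and_beyond
    (fun ρ s => ∑ᶠ M ∈ {M : Submodule 𝒪[K] (Fin 3 → K) | M ∈ stratum σ ϖ T ![2 * ρ + s, 2 * ρ + s, 2 * ρ] ∧
          (LatticeInLevel ϖ (d % 2) (Matrix.diagonal ![α - 1, β - 1, 0]) M ∧ ¬ LatticeInLevel ϖ (d % 2 + 1) (Matrix.diagonal ![α - 1, β - 1, 0]) M ∧
            LatticeInLevel ϖ (mcOfRecord d) (Matrix.diagonal ![(α - 1) * (α - 1), (β - 1) * (β - 1), 0]) M)},
        (labelledOddCount σ ϖ 0 i (valueClassLabel σ ϖ (α - 1) (β - 1) (mstarOfRecord d) d) M : ℚ) /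
          ((((unitStabilizer M).map (unitNormMap σ 3)).relIndex (fixedUnitTorus σ 3) : ℕ) : ℚ))
    (Fintype.card 𝓀[K]) (normSign σ eC) (normSign σ (-1 : K)) hiso hp1 hp2 hp3 i
    (fun ρ s hρ hs hc => finsum_stratum_G3_shell_labelledOdd_div_relIndex_eq_ofRecord hD h2 h2d hE hdN₀ hmc T hT ρ s hρ hs hc hσeC heC1 heC i)
    (fun ρ s hρ hlt hP h2s hcap => finsum_stratum_G3_shell_labelledOdd_div_relIndex_beyond hD h2 h2d hE hdN₀ hmc T hT ρ s hρ hlt hP h2s hcap hσeC heC1 heC i)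
    ρ s hρ hP h2s hcap


end Summit.HodgeConjecture.HodgeConjecture.Cruxes.H413.F0P3cDyRamOddLabelledTubeRowsOfRecord

end
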